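import Mathlib.NumberTheory.Cyclotomic.CyclotomicCharacter
import Mathlib.RingTheory.RootsOfUnity.AlgebraicallyClosed
import Literature.AlgebraicGeometry.Motives.FrobeniusTrace
import HarnessLib

/-!
# `ℓ`-adic cohomology over a finite field as a Galois Weil cohomology theory (named fact)

The accepted preludes `WeilCohomology` (C9), `GaloisRealization` (C12) and `FrobeniusTrace`
(C4) axiomatise, as *hypothesis structures*, a Weil cohomology theory on smooth projective
varieties over a field `k` with a compatible action of `Γ_k = Gal(k̄/k)`
(`Literature.GaloisWeilCohomology k K χ`) and, over a finite field, the Grothendieck–Lefschetz trace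
formula (`E.HasLefschetzTraceFormula`). Their intended value is `ℓ`-adic étale cohomology
`X ↦ H•_ét(X_{k̄}, ℚ_ℓ)`, `ℓ ≠ char k`, twisted by the `ℓ`-adic cyclotomic character
`Literature.padicCyclotomicCharacter k ℓ`; neither Mathlib (whose `Scheme.EllAdicCohomology` carries no
module structure, functoriality or Galois action yet) nor the Literature tree constructs it.

This file records the corresponding **existence statement** as a named fact
(`Literature.AlgebraicGeometry.Motives.exists_galoisWeilCohomology_hasLefschetzTraceFormula`, statement only), to which the
consequences of the cohomological formalism over finite fields reduce (rationality and the
functional equation of `Z(X, T)`: Grothendieck, Sém. Bourbaki 279; Kahn 2020, Thm. 3.65 "if there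
exists a Weil cohomology on `V(𝔽_q)` …"; see
`Literature/NumberTheory/LFunctions/WeilConjecturesFunctionalEquationProofs.lean`), together with
the elementary fact needed to use it:

* `Literature.AlgebraicGeometry.Motives.padicCyclotomicCharacter_arithFrob`: the cyclotomic character takes the value `q = #k` on
  the arithmetic Frobenius `φ : x ↦ x^q` (so that the geometric Frobenius acts on
  `H²ⁿ(X) ≅ ℚ_ℓ(-n)` by `qⁿ`), proved from Mathlib's `cyclotomicCharacter.toZModPow` /
  `modularCyclotomicCharacter.unique` via the general
  `Literature.AlgebraicGeometry.Motives.val_cyclotomicCharacter_eq_natCast_of_forall`.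

## References

* P. Deligne, *La conjecture de Weil. I*, Publ. Math. IHÉS 43 (1974): (1.5.1) (trace formula),
  (1.10) (finiteness, vanishing above `2 dim`), Thm. (2.3)–(2.4) (Poincaré duality, Galois
  compatibility), (2.15) D), E) (references to SGA 4 XVII, XVIII and SGA 5). [Deligne1974]
* A. Grothendieck, *Formule de Lefschetz et rationalité des fonctions L*, Sém. Bourbaki 279
  (1964/65). [Grothendieck1965]
* S. Kleiman, *Algebraic cycles and the Weil conjectures*, in Dix exposés (1968), §1.2 (axioms
  (A)–(C) of a Weil cohomology). [Kleiman1968AlgebraicCycles]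
* B. Kahn, *Zeta and L-functions of varieties and motives* (2020), §3.5.9 (the classical Weil
  cohomologies, among them `ℓ`-adic cohomology) and Thm. 3.65. [Kahn2020]
* J. Tate, *Conjectures on algebraic cycles in `ℓ`-adic cohomology*, PSPM 55 (1994), §1 (Galois
  compatibilities, cycle classes are Galois invariant). [Tate1994]
* J.-P. Serre, *Abelian `ℓ`-adic representations* (1968), I.1.2 (the cyclotomic character,
  `χ_ℓ(Frob_q) = q`).

## Design notes

* The fact is stated per finite field `k` and for every prime `ℓ` invertible in `k`, with the
  concrete coefficients `ℚ_[ℓ]` and the concrete character `padicCyclotomicCharacter k ℓ` of the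
  accepted prelude `GaloisRealization` (no existential over coefficient fields).
* It bundles several theorems of SGA 4, 4½, 5 (finiteness, Poincaré duality, Künneth, cycle
  class, trace formula, Galois compatibilities) into one existence statement matching the fields
  of `Literature.AlgebraicGeometry.Motives.GaloisWeilCohomology`; it asserts nothing beyond what these sources prove for `ℓ`-adic
  cohomology of smooth projective (geometrically irreducible) varieties, and in particular does
  not include hard Lefschetz (`WeilCohomology.HasHardLefschetz`) or the Riemann hypothesis
  (`E.WeilRiemannHypothesisFor`), which are separate predicates.
* Mathlib searches: `cyclotomicCharacter`, `cyclotomicCharacter.toZModPow`,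
  `modularCyclotomicCharacter.unique`, `PadicInt.ext_of_toZModPow`,
  `AlgebraicClosure.hasEnoughRootsOfUnity_pow` are used; Mathlib has no lemma evaluating the
  cyclotomic character on a Frobenius (searched `cyclotomicCharacter.*[Ff]rob`).
-/

universe u

open CategoryTheory AlgebraicGeometry

noncomputable section

namespace Literature.AlgebraicGeometry.Motives

/-! ### The cyclotomic character on Frobenius -/

/-- **Values of the cyclotomic character from its defining property.** Let `L` be a domain with
all `pⁱ`-th primitive roots of unity and `g` a ring automorphism of `L` acting on every `p`-power
root of unity `t` by `g t = t ^ q` for a fixed natural number `q`. Then Mathlib's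
`cyclotomicCharacter L p g ∈ ℤ_pˣ` has underlying `p`-adic integer `q` (at each level `pⁿ`,
`modularCyclotomicCharacter.unique` with `c = q mod pⁿ`, then `PadicInt.ext_of_toZModPow`)
(Serre, *Abelian `ℓ`-adic representations*, I.1.2: `χ` is characterised by `g ζ = ζ^{χ(g)}`).
[folklore] -/
theorem val_cyclotomicCharacter_eq_natCast_of_forall {L : Type*} [CommRing L] [IsDomain L]
    (p : ℕ) [Fact p.Prime] [∀ i, HasEnoughRootsOfUnity L (p ^ i)] (g : L ≃+* L) (q : ℕ)
    (hg : ∀ (n : ℕ) (t : L), t ^ p ^ n = 1 → g t = t ^ q) :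
    ((cyclotomicCharacter L p g : ℤ_[p]ˣ) : ℤ_[p]) = q := by
  classical
  refine PadicInt.ext_of_toZModPow.mp fun n => ?_
  rw [map_natCast, cyclotomicCharacter.toZModPow]
  rw [← modularCyclotomicCharacter.unique L
    (HasEnoughRootsOfUnity.natCard_rootsOfUnity L (p ^ n)) g (c := (q : ZMod (p ^ n))) ?_]
  intro t ht
  have ht' : (t : L) ^ p ^ n = 1 := by
    have := congrArg Units.val ((mem_rootsOfUnity _ t).mp ht)
    simpa using this
  rw [hg n t ht', ZMod.val_natCast]
  conv_lhs => rw [← Nat.div_add_mod q (p ^ n), pow_add, pow_mul, ht', one_pow, one_mul]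

variable {k : Type u} [Field k] [Finite k]

/-- **The `ℓ`-adic cyclotomic character of a finite field takes the value `q = #k` on the
arithmetic Frobenius** `φ : x ↦ x^q` (`ℓ` invertible in `k`): `χ_ℓ(φ) = q` in `ℚ_ℓ`, since
`φ ζ = ζ^q` for every root of unity `ζ ∈ k̄` (Serre, *Abelian `ℓ`-adic representations*, I.1.2;
Deligne, *Weil I*, (2.2): `φ` acts on `ℚ_ℓ(1)` by multiplication by `q`). Consequently the
geometric Frobenius `F = φ⁻¹` acts on `ℚ_ℓ(-n)`, hence on `H²ⁿ(X)`, by `qⁿ`. This is the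
hypothesis `hχ` of
`Literature.NumberTheory.LFunctions.hasFunctionalEquation_zetaSeries_of_galoisWeilCohomology` for
`χ = padicCyclotomicCharacter k ℓ`. [cite: Deligne1974, (2.2)] -/
theorem padicCyclotomicCharacter_arithFrob (ℓ : ℕ) [Fact ℓ.Prime] (hℓ : (ℓ : k) ≠ 0) :
    ((padicCyclotomicCharacter k ℓ (arithFrob k) : ℚ_[ℓ]ˣ) : ℚ_[ℓ]) = Nat.card k := by
  haveI : NeZero (ℓ : k) := ⟨hℓ⟩
  have h := val_cyclotomicCharacter_eq_natCast_of_forall ℓ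
    (MulSemiringAction.toRingAut (Field.absoluteGaloisGroup k) (AlgebraicClosure k) (arithFrob k))
    (Nat.card k) fun n t _ => arithFrob_smul t
  simp only [padicCyclotomicCharacter, MonoidHom.coe_comp, Function.comp_apply, Units.coe_map,
    MonoidHom.coe_coe]
  rw [h]
  simp

/-! ### The existence fact -/

variable (k) in
/-- **`ℓ`-adic cohomology over a finite field is a Weil cohomology theory with Galois action
satisfying the Grothendieck–Lefschetz trace formula** (named fact, statement only). For the
finite field `k` (`q = #k`) and every prime `ℓ` invertible in `k` there is a Weil cohomology
theory with Galois action `E : GaloisWeilCohomology k ℚ_ℓ χ_ℓ`, `χ_ℓ = padicCyclotomicCharacter k ℓ`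
the `ℓ`-adic cyclotomic character — the intended witness being `X ↦ H•_ét(X_{k̄}, ℚ_ℓ)` with its
cup product, trace, cycle classes and natural `Gal(k̄/k)`-action — satisfying the Lefschetz trace
formula `E.HasLefschetzTraceFormula`:
`#X(𝔽_{q^m}) = ∑_{i ≤ 2n} (-1)ⁱ tr(Fᵐ | Hⁱ(X))` for `X` smooth projective of dimension `n`, `F` the
geometric Frobenius. Sources for the constituent theorems about `ℓ`-adic cohomology of smooth
projective varieties: finiteness and vanishing above `2 dim X`, Poincaré duality and its
compatibility with `Gal(k̄/k)` — Deligne, *Weil I*, (1.10), Thm. (2.3), (2.4) (after SGA 4 XVII,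
XVIII, cf. (2.15) D), E)); the trace formula — Grothendieck, Sém. Bourbaki 279, and Deligne,
(1.5.1); the Künneth formula and the cycle class map (Kleiman's axioms (B), (C)) — Kleiman 1968,
§1.2, and Kahn 2020, §3.5.9 ("classical Weil cohomologies", `ℓ`-adic cohomology among them);
the Galois compatibilities of pull-backs, cup products, trace and cycle classes — Tate 1994, §1.
The statement bundles these theorems into one existence claim matching the hypothesis structure
`Literature.AlgebraicGeometry.Motives.GaloisWeilCohomology`; it does not include hard Lefschetz or the Riemann hypothesis
(separate predicates `WeilCohomology.HasHardLefschetz`, `E.WeilRiemannHypothesisFor`).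
Discharging it amounts to constructing étale cohomology with these properties.
[cite: Deligne1974, (1.5.1), (1.10), Thm. (2.3), (2.4)] [cite: Grothendieck1965, §5]
[cite: Kleiman1968AlgebraicCycles, §1.2] [cite: Kahn2020, §3.5.9 and Thm. 3.65]
[cite: Tate1994, §1] -/
def exists_galoisWeilCohomology_hasLefschetzTraceFormula : Prop :=
  ∀ (ℓ : ℕ) [Fact ℓ.Prime], (ℓ : k) ≠ 0 →
    ∃ E : GaloisWeilCohomology k ℚ_[ℓ] (padicCyclotomicCharacter k ℓ), E.HasLefschetzTraceFormula

/-- Unfolding lemma for `exists_galoisWeilCohomology_hasLefschetzTraceFormula`: from the fact and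
an admissible prime one gets a Galois Weil cohomology theory with the trace formula whose
character takes the value `q` on the arithmetic Frobenius — exactly the hypotheses `(E, hE, hχ)`
consumed by `Literature.NumberTheory.LFunctions.hasFunctionalEquation_zetaSeries_of_galoisWeilCohomology`. [folklore] -/
theorem exists_galoisWeilCohomology_hasLefschetzTraceFormula.elim
    (h : exists_galoisWeilCohomology_hasLefschetzTraceFormula k) (ℓ : ℕ) [Fact ℓ.Prime]
    (hℓ : (ℓ : k) ≠ 0) :
    ∃ E : GaloisWeilCohomology k ℚ_[ℓ] (padicCyclotomicCharacter k ℓ),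
      E.HasLefschetzTraceFormula ∧
        ((padicCyclotomicCharacter k ℓ (arithFrob k) : ℚ_[ℓ]ˣ) : ℚ_[ℓ]) = Nat.card k := by
  obtain ⟨E, hE⟩ := h ℓ hℓ
  exact ⟨E, hE, padicCyclotomicCharacter_arithFrob ℓ hℓ⟩

/-- Prime-free form of `exists_galoisWeilCohomology_hasLefschetzTraceFormula.elim`: from the fact
one gets, for *some* prime `ℓ` (any prime other than the characteristic of `k` will do), a Galois
Weil cohomology theory `E : GaloisWeilCohomology k ℚ_ℓ χ_ℓ` with the Lefschetz trace formula and
`χ_ℓ(φ) = q` — the form consumed by statements that do not mention `ℓ` (rationality and the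
functional equation of `Z(X, T)`). [folklore] -/
theorem exists_galoisWeilCohomology_hasLefschetzTraceFormula.exists_prime
    (h : exists_galoisWeilCohomology_hasLefschetzTraceFormula k) :
    ∃ (ℓ : ℕ) (_ : Fact ℓ.Prime)
      (E : GaloisWeilCohomology k ℚ_[ℓ] (padicCyclotomicCharacter k ℓ)),
      E.HasLefschetzTraceFormula ∧
        ((padicCyclotomicCharacter k ℓ (arithFrob k) : ℚ_[ℓ]ˣ) : ℚ_[ℓ]) = Nat.card k := by
  -- a prime `ℓ` invertible in `k`: any prime above the characteristic
  obtain ⟨p, hp⟩ := CharP.exists k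
  have hpp : p.Prime := CharP.char_is_prime k p
  obtain ⟨ℓ, hle, hℓp⟩ := Nat.exists_infinite_primes (p + 1)
  have hℓ : (ℓ : k) ≠ 0 := fun h0 => by
    rw [CharP.cast_eq_zero_iff k p ℓ, Nat.prime_dvd_prime_iff_eq hpp hℓp] at h0
    omega
  haveI : Fact ℓ.Prime := ⟨hℓp⟩
  exact ⟨ℓ, this, h.elim ℓ hℓ⟩

end Literature.AlgebraicGeometry.Motives

end
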